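import Literature.MathematicalPhysics.QuantumFieldTheory.Balaban1983to89.B3Eq114AveragingVertices
import Literature.MathematicalPhysics.QuantumFieldTheory.Balaban1983to89.B3Eq15ChargeSecondOrder

/-!
# `Balaban1983to89.B3Eq15ChargeVertexCatalogue` — T. Bałaban, *(Higgs)₂,₃ quantum fields in a finite volume. III.
Renormalization*, Commun. Math. Phys. **88** (1983) 411–445 [Balaban1983Higgs3], p. 414 [PDF 4]: *"Let us notice
that the vertices of (1.5) are given by (1.6)–(1.8), (1.10), (1.13), and (1.14) with n′ = 0 and B̃ = A^{(k)}."* — AT THE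
LEVEL OF (1.5) ITSELF, TO FIRST ORDER IN `e′`, for the typed auxiliary function `E_k` of (1.4)
(`B3Eq14AuxFunction.Data14.auxE`): the CHARGE VERTEX of `B3Eq15ChargeDerivative` (whose normalized expectation IS the
`e′`-term of `𝒫^{(k)}_{n̄=1}`, `interaction15R_one_eq_expectations`) is, at `e′ = 0`, print's catalogue: minus the vertex
**(1.8)_{1,0}** at `B̃ = A^{(k)}`, `Ã = 0` (bonds inside `Ω`), plus `a_k(L^kη)^{d−2}·Σ_{y∈Ω^{(k)}}⟨(1.12)+(1.13), (1.14)_{1,0}⟩`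
(the p. 414 pairing of two DIFFERENT expressions, factor `−a_k`, inside `−∂_{e′}`), minus the counterterm vertex (1.7) with
`δm_i² = ∂_{e′}δm²(0,λ′,·)`, plus `∂_{e′}E₁(0,λ′)`; bridges the typer's `B3Eq18VertexExpansion` ((1.6)–(1.11)),
`B3Eq114AveragingVertices` ((1.12)–(1.15)) and `B3Eq15ChargeDerivative` (the `e′`-derivative of (1.4))

statement-level skeleton of published theorems with citation tags; proofs where landed; nothing here is a claim about
the Yang–Mills mass gap

CITATION HEADER (lean-in-tree rule).  lit-balaban TYPED SKELETON (HOME `run/shared/lean/pub/lit-balaban/`), rows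
**B3.Eq1.5** (owner r15; head `typed p243757`), B3.Eq1.6-1.11 / B3.Eq1.12-1.15 (owner r15), B3.Eq1.4 (typer).  LOCATED
MEMBER, cells only, no head claim.  Unit `lit-balaban-typer` gen 29 (literature-prover-lit-balaban-typer-g29-0).

THE ARGUMENT (ours).  Derivatives are unique: `B3Eq15ChargeDerivative.hasDerivAt_half_siteInner_scalarOp` /
`hasDerivAt_avgQ14_apply` give the `e′`-derivatives of the kinetic form and of the block averages as `dirichletVertex`,
`dAvgQ14`; `B3Eq18VertexExpansion.taylorCoeff_density14_kinetic` and `B3Eq114AveragingVertices.taylorCoeff_avgQ14_noSmallField`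
give the first `e′`-Taylor coefficients of the same functions as (1.8)_{1,0} and (1.14)_{1,0}; (1.10) does not occur at
order 1 (`n + n′` even).

WHAT IS PROVED (theorems only; no definition, no `Prop` fact; axioms standard):
* §1 `dirichletVertex_zero_eq` (`dirichletVertex at e′ = 0 = −(1.8)_{1,0}` over the bonds inside `Ω`, `B̃ = A^{(k)}`, `Ã = 0`,
  `A′ ↦ g_k𝒜`); `avgQ14_zero_eq` (`(Q_k(A^{(k)})φ′)(y) = −(1.13)`), `dAvgQ14_zero_eq` (`∂_{e′}|₀(Q_k(e′g_k𝒜+A^{(k)})φ′)(y)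
  = −(1.14)_{1,0}`, weight `L^{−kd}`, contour functionals as in `B3Eq114AveragingVertices` §5);
* §2 **`kernelVertex_zero_eq`** (`= a_k(L^kη)^{d−2}Σ_{y∈Ω^{(k)}}⟨(1.12)+(1.13), (1.14)_{1,0}⟩`) and its pairing-rule reading
  `kernelVertex_zero_eq_pairing` (`= −Σ_y` of the order-1 coefficient `−½a Σ_{i+j=1}⟨E_i,E_j⟩` of
  `B3Eq114AveragingVertices.pairing_taylorCoeff`);
* §3 **`chargeVertex_zero_eq`** (the catalogue above) and **`interaction15R_one_eq_vertices`**: under the hypotheses of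
  `B3Eq15ChargeDerivative.interaction15R_one_eq_expectations`, `𝒫^{(k)}_{n̄=1} = ⟨catalogue⟩₀ + ⟨λ′-vertex⟩₀`.
* §4 (v1.1, append-only, same unit) SECOND ORDER: `d2AvgQ14_zero_eq` (`∂²_{e′}|₀(Q_kφ′)(y) = −2·(1.14)_{2,0}`),
  `dDirichletVertex_zero_eq` (`= −2·((1.8)_{2,0} + (1.10)_{2,0})`), **`dKernelVertex_zero_eq`**
  (`= a_k(L^kη)^{d−2}Σ_y(2⟨(1.12)+(1.13), (1.14)_{2,0}⟩ + |(1.14)_{1,0}|²)` = `−2!·Σ_y` of the order-2 coefficient of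
  `pairing_taylorCoeff`, `dKernelVertex_zero_eq_pairing`), **`dChargeVertex_zero_eq`** (the `e′`-derivative of the charge
  vertex of `B3Eq15ChargeSecondOrder` at `0` = `−2!·`[the order-2 vertices (1.8)_{2,0} + (1.10)_{2,0} + the pairs + (1.7) with
  `½∂²_{e′}δm²` − `½∂²_{e′}E₁`]), `catalogue1`/`catalogue2` (defs naming the two catalogues) and
  **`interaction15R_two_eq_vertices`** (`𝒫^{(k)}_{n̄=2}` of `interaction15R_two_eq_expectations` with both charge vertices
  replaced by print's vertices).
* §5 (v1.2, append-only) EVERY ORDER `n ≥ 1` at the level of the exponent of the integrand: `contDiff_kinetic14`,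
  `contDiff_log_kernel14`, **`taylorCoeff_log_kernel_kinetic`** ((1/n!)∂ⁿ_{e′}|₀[log t(Ω;φ,φ′) − ½⟨φ′,(−Δ_{𝒜(e′)})φ′⟩]
  = Σ_y pairings_n(y) + (1.8)_{n,0} + [n even](1.10)_{n,0}; the counterterm vertices add linearly).
* §6 (v1.3, append-only) the WHOLE exponent, counterterms included: `kernel14_pos`, `iteratedDeriv_vertex17` (linearity of (1.7)
  in `δm_i²` along a `Cⁿ` family), **`taylorCoeff_log_fibre14`** ((1/n!)∂ⁿ_{e′}|₀ log(t·exp[…]) = Σ_y pairings_n(y) + (1.8)_{n,0}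
  + [n even](1.10)_{n,0} + (1.7)[(1/n!)∂ⁿδm²(0,λ′,·)] − (1/n!)∂ⁿE₁(0,λ′), data `Cⁿ` in `e′`).
HONEST SCOPE: orders 1 and 2 in `e′` for (1.5) itself (n̄ ≦ 2); every order for the exponent of the integrand; expectations
are left as the normalized product integrals of `B3Eq15ChargeDerivative`/`B3Eq15ChargeSecondOrder` (no Wick contraction, no graphs).
-/

open scoped BigOperators InnerProductSpace
open MeasureTheory

namespace Literature.MathematicalPhysics.QuantumFieldTheory.Balaban1983to89.B3Eq15ChargeVertexCatalogue

open Literature.MathematicalPhysics.QuantumFieldTheory.Balaban1983to89.HiggsLattice (ChargeData covDeriv siteInner)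
open Literature.MathematicalPhysics.QuantumFieldTheory.Balaban1983to89.HiggsAveraging (blockK)
open Literature.MathematicalPhysics.QuantumFieldTheory.Balaban1983to89.HiggsCovariance (E covLaplacianN)
open Literature.MathematicalPhysics.QuantumFieldTheory.Balaban1983to89.B3MultiscaleFields (etaSumK)
open Literature.MathematicalPhysics.QuantumFieldTheory.Balaban1983to89.HiggsFluctMeasure
open Literature.MathematicalPhysics.QuantumFieldTheory.Balaban1983to89.B1RT (prec)
open Literature.MathematicalPhysics.QuantumFieldTheory.Balaban1983to89.B3Eq14AuxFunction
open Literature.MathematicalPhysics.QuantumFieldTheory.Balaban1983to89.B3Eq14Finite (lamVertex lamVertex2)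
open Literature.MathematicalPhysics.QuantumFieldTheory.Balaban1983to89.B3Eq15ChargeSecondOrder
open Literature.MathematicalPhysics.QuantumFieldTheory.Balaban1983to89.B3Eq15ChargeDerivative
open Literature.MathematicalPhysics.QuantumFieldTheory.Balaban1983to89.B3Eq18VertexExpansion
  (vertex17 vertex18 vertex110 insideBonds taylorCoeff_density14_kinetic)
open Literature.MathematicalPhysics.QuantumFieldTheory.Balaban1983to89.B3Eq114AveragingVertices
  (vertex112 vertex113 vertex114 avgTerm coeffExpr taylorCoeff_avgQ14_noSmallField pairing_taylorCoeff)

noncomputable section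

variable {P : HiggsLattice.Params} {N K : ℕ} (D : Data14 P N K)

/-! ## §1. The kinetic form and the block averages at `e′ = 0` -/

/-- **`dirichletVertex` at `e′ = 0` is `−(1.8)_{1,0}`** (bonds inside `Ω`, `B̃ = A^{(k)}`, `Ã = 0`, fluctuation field
`g_k𝒜`): the `e′`-derivative at `0` of `½⟨φ′,(−Δ^η_{e′g_k𝒜+A^{(k)},Ω} + m²(L^kε)²)φ′⟩`. [cite: Balaban1983Higgs3, p.414 (after (1.15)), (1.8) p.413] -/
theorem dirichletVertex_zero_eq (Ak : HiggsLattice.VecField P 0) (A' : (j : Fin K) → HiggsLattice.VecField P j)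
    (φ' : HiggsLattice.ScalarField P 0 N) :
    dirichletVertex D Ak A' φ' 0 = -vertex18 D.C D.g Ak (D.fluctSum A') 0 φ' 1 0 (insideBonds D.Ω) := by
  -- the two functions of `e′` differ by the (constant) mass term
  set g : ℝ → ℝ := fun e' => -(1 / 2 : ℝ) * siteInner φ' (covLaplacianN D.C D.Ω (D.extField Ak e' A') φ') with hg
  have hsplit : ∀ u : ℝ, siteInner φ' (D.scalarOp Ak u A' φ')
      = siteInner φ' (covLaplacianN D.C D.Ω (D.extField Ak u A') φ') + (D.m2 * D.ell ^ 2) * siteInner φ' φ' := fun u => by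
    rw [Data14.scalarOp_eq]
    unfold siteInner
    rw [Finset.mul_sum, ← Finset.sum_add_distrib]
    refine Finset.sum_congr rfl fun x _ => ?_
    rw [LinearMap.add_apply, LinearMap.smul_apply, LinearMap.id_apply, Pi.add_apply, Pi.smul_apply, inner_add_right,
      real_inner_smul_right]
    ring
  have hfg : g = fun u => -((1 / 2 : ℝ) * siteInner φ' (D.scalarOp Ak u A' φ'))
      + (1 / 2 : ℝ) * (D.m2 * D.ell ^ 2) * siteInner φ' φ' := by
    funext u
    simp only [hg, hsplit]
    ring
  have h1 : HasDerivAt g (-dirichletVertex D Ak A' φ' 0) 0 := by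
    rw [hfg]
    exact (hasDerivAt_half_siteInner_scalarOp D Ak A' φ' 0).neg.add_const _
  have h2 := taylorCoeff_density14_kinetic D Ak A' φ' (le_refl 1)
  rw [← hg, iteratedDeriv_one, h1.deriv, Nat.factorial_one, Nat.cast_one, inv_one, one_mul,
    if_neg Nat.not_even_one, add_zero] at h2
  linarith

/-- **`(Q_k(A^{(k)})φ′)(y) = −(1.13)`** at `B̃ = A^{(k)}` (weight `L^{−kd}`, `β = A^{(k)}(Γ^{(k)}_{y,x})`).
[cite: Balaban1983Higgs3, (1.13) p.413] -/
theorem avgQ14_zero_eq (Ak : HiggsLattice.VecField P 0) (A' : (j : Fin K) → HiggsLattice.VecField P j)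
    (φ' : HiggsLattice.ScalarField P 0 N) (y : HiggsLattice.Site P K) :
    D.avgQ14 Ak 0 A' φ' y = -vertex113 D.C (((P.L : ℝ) ^ (K * P.d))⁻¹) (fun x => etaSumK Ak K x) φ' K y := by
  rw [Data14.avgQ14_apply]
  unfold vertex113
  rw [neg_neg]
  congr 1
  refine Finset.sum_congr rfl fun x _ => ?_
  rw [B3MultiscaleFields.holK13, contour13_extPieces, zero_mul, add_zero]

/-- **`∂_{e′}|₀(Q_k(e′g_k𝒜 + A^{(k)})φ′)(y) = −(1.14)_{1,0}`** (`α = a_x(A′)` = `fluctContour`, `Ã = 0`).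
[cite: Balaban1983Higgs3, (1.14) p.413] -/
theorem dAvgQ14_zero_eq (Ak : HiggsLattice.VecField P 0) (A' : (j : Fin K) → HiggsLattice.VecField P j)
    (φ' : HiggsLattice.ScalarField P 0 N) (y : HiggsLattice.Site P K) :
    dAvgQ14 D Ak A' φ' 0 y
      = -vertex114 D.C (((P.L : ℝ) ^ (K * P.d))⁻¹) (fun x => etaSumK Ak K x) (fluctContour D A') (fun _ => 0)
          φ' K 1 0 y := by
  have h1 : HasDerivAt (fun u => -(D.avgQ14 Ak u A' φ' y)) (-dAvgQ14 D Ak A' φ' 0 y) 0 :=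
    (hasDerivAt_avgQ14_apply D Ak A' φ' y 0).neg
  have h2 := taylorCoeff_avgQ14_noSmallField D Ak A' φ' y (le_refl 1)
  rw [iteratedDeriv_one, h1.deriv, Nat.factorial_one, Nat.cast_one, inv_one, one_smul] at h2
  rw [← h2, neg_neg]

/-! ## §2. The kernel vertex at `e′ = 0`: the pair ((1.12)+(1.13))·(1.14)_{1,0} -/

/-- **`kernelVertex` at `e′ = 0` = `a_k(L^kη)^{d−2}·Σ_{y∈Ω^{(k)}}⟨(1.12) + (1.13), (1.14)_{1,0}⟩`** — the p. 414 pairing of the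
two DIFFERENT expressions `φ(y) − (Q_k(A^{(k)})φ′)(y)` and (1.14)_{1,0} (factor `−a_k`; `kernelVertex` is MINUS the
`e′`-derivative of the exponent). [cite: Balaban1983Higgs3, p.414 (after (1.15))] -/
theorem kernelVertex_zero_eq (Ak : HiggsLattice.VecField P 0) (A' : (j : Fin K) → HiggsLattice.VecField P j)
    (φ : HiggsLattice.ScalarField P K N) (φΩ : ↥D.Ω → E N) :
    kernelVertex D Ak A' φ φΩ 0
      = prec (B1.aSeq D.a P.L K) (P.mesh K) P.d
        * ∑ y : ↥D.Ωk, ⟪vertex112 φ y.1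
              + vertex113 D.C (((P.L : ℝ) ^ (K * P.d))⁻¹) (fun x => etaSumK Ak K x) (extendZero D.Ω φΩ) K y.1,
            vertex114 D.C (((P.L : ℝ) ^ (K * P.d))⁻¹) (fun x => etaSumK Ak K x) (fluctContour D A') (fun _ => 0)
              (extendZero D.Ω φΩ) K 1 0 y.1⟫_ℝ := by
  rw [kernelVertex_def]
  simp only [avgQ14_zero_eq, dAvgQ14_zero_eq, inner_neg_right, Finset.sum_neg_distrib, mul_neg, neg_neg, sub_neg_eq_add]
  rfl

/-- The same as the order-1 case of the pairing rule at the level of the `e′`-Taylor coefficients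
(`B3Eq114AveragingVertices.pairing_taylorCoeff`, `n = 1`, `Ã = 0`): `kernelVertex(0) = −Σ_{y∈Ω^{(k)}}(−½a Σ_{i+j=1}⟨E_i(y), E_j(y)⟩)`
with `a = a_k(L^kη)^{d−2}`, `E_0 = (1.12)+(1.13)`, `E_1 = (1.14)_{1,0}` (`coeffExpr`). [cite: Balaban1983Higgs3, p.414 (after (1.15))] -/
theorem kernelVertex_zero_eq_pairing (Ak : HiggsLattice.VecField P 0) (A' : (j : Fin K) → HiggsLattice.VecField P j)
    (φ : HiggsLattice.ScalarField P K N) (φΩ : ↥D.Ω → E N) (nbar : ℕ) :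
    kernelVertex D Ak A' φ φΩ 0
      = -∑ y : ↥D.Ωk, (-(1 / 2 : ℝ) * prec (B1.aSeq D.a P.L K) (P.mesh K) P.d
          * ∑ ij ∈ Finset.HasAntidiagonal.antidiagonal 1,
              ⟪coeffExpr D.C (((P.L : ℝ) ^ (K * P.d))⁻¹) (fun x => etaSumK Ak K x) (fluctContour D A') (fun _ => 0)
                  (extendZero D.Ω φΩ) K y.1 φ nbar ij.1,
                coeffExpr D.C (((P.L : ℝ) ^ (K * P.d))⁻¹) (fun x => etaSumK Ak K x) (fluctContour D A') (fun _ => 0)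
                  (extendZero D.Ω φΩ) K y.1 φ nbar ij.2⟫_ℝ) := by
  rw [kernelVertex_zero_eq, Finset.mul_sum, ← Finset.sum_neg_distrib]
  refine Finset.sum_congr rfl fun y _ => ?_
  -- the coefficient expressions with no small field: `E_0 = (1.12)+(1.13)`, `E_1 = (1.14)_{1,0}`
  set w : ℝ := ((P.L : ℝ) ^ (K * P.d))⁻¹ with hw
  set β : HiggsLattice.Site P 0 → ℝ := fun x => etaSumK Ak K x with hβ
  set φ' := extendZero D.Ω φΩ with hφ'
  have hE0 : coeffExpr D.C w β (fluctContour D A') (fun _ => 0) φ' K y.1 φ nbar 0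
      = vertex112 φ y.1 + vertex113 D.C w β φ' K y.1 := by
    unfold coeffExpr
    rw [if_pos rfl, B3Eq114AveragingVertices.vertex115_noSmallField, add_zero, Finset.sum_eq_zero fun n' hn' => ?_,
      add_zero]
    rw [Finset.mem_filter] at hn'
    exact B3Eq114AveragingVertices.vertex114_noSmallField D.C w β (fluctContour D A') φ' K y.1 (by omega) 0
  have hE1 : coeffExpr D.C w β (fluctContour D A') (fun _ => 0) φ' K y.1 φ nbar 1
      = vertex114 D.C w β (fluctContour D A') (fun _ => 0) φ' K 1 0 y.1 := by
    unfold coeffExpr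
    rw [if_neg one_ne_zero, zero_add, B3Eq114AveragingVertices.vertex115_noSmallField, add_zero]
    have hf : (Finset.range (nbar + 1)).filter (fun n' => 1 ≤ 1 + n') = insert 0 ((Finset.range (nbar + 1)).filter (fun n' => 1 ≤ n')) := by
      ext n'
      simp only [Finset.mem_filter, Finset.mem_range, Finset.mem_insert]
      omega
    rw [hf, Finset.sum_insert (by simp), Finset.sum_eq_zero fun n' hn' => ?_, add_zero]
    rw [Finset.mem_filter] at hn'
    exact B3Eq114AveragingVertices.vertex114_noSmallField D.C w β (fluctContour D A') φ' K y.1 hn'.2 1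
  have hanti : Finset.HasAntidiagonal.antidiagonal 1 = {((0 : ℕ), 1), (1, 0)} := by decide
  rw [hanti, Finset.sum_pair (by decide), hE0, hE1, real_inner_comm (vertex114 D.C w β _ _ φ' K 1 0 y.1)]
  ring

/-! ## §3. The charge vertex at `e′ = 0`: print's catalogue to first order -/

/-- **p. 414 for (1.5) at `n̄ = 1`: the charge vertex at `e′ = 0` is the catalogue** —
`chargeVertex(0) = a_k(L^kη)^{d−2}Σ_{y∈Ω^{(k)}}⟨(1.12)+(1.13), (1.14)_{1,0}⟩ − (1.8)_{1,0}|_{B̃=A^{(k)}, Ã=0, bonds⊂Ω}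
− (1.7)|_{δm_i² = ∂_{e′}δm²(0,λ′,·)} + ∂_{e′}E₁(0,λ′)` (no (1.10) at order 1: `n + n′` must be even; no (1.6): it carries no
`e′`). [cite: Balaban1983Higgs3, p.414 (after (1.15)), (1.5)–(1.8) pp.412–413] -/
theorem chargeVertex_zero_eq (lam' : ℝ) (Ak : HiggsLattice.VecField P 0) (φ : HiggsLattice.ScalarField P K N)
    (z : ((i : Fin K) → HiggsLattice.VecField P i) × (↥D.Ω → E N)) :
    chargeVertex D lam' Ak φ 0 z
      = prec (B1.aSeq D.a P.L K) (P.mesh K) P.d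
          * ∑ y : ↥D.Ωk, ⟪vertex112 φ y.1
                + vertex113 D.C (((P.L : ℝ) ^ (K * P.d))⁻¹) (fun x => etaSumK Ak K x) (extendZero D.Ω z.2) K y.1,
              vertex114 D.C (((P.L : ℝ) ^ (K * P.d))⁻¹) (fun x => etaSumK Ak K x) (fluctContour D z.1) (fun _ => 0)
                (extendZero D.Ω z.2) K 1 0 y.1⟫_ℝ
        - vertex18 D.C D.g Ak (D.fluctSum z.1) 0 (extendZero D.Ω z.2) 1 0 (insideBonds D.Ω)
        - vertex17 (fun x => deriv (fun u => D.dm2 u lam' x) 0) D.ell D.Ω₁ (extendZero D.Ω z.2)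
        + deriv (fun u => D.E1 u lam') 0 := by
  rw [chargeVertex_def, kernelVertex_zero_eq, densityVertex_def, dirichletVertex_zero_eq]
  unfold vertex17
  have hs : ∑ x ∈ D.Ω₁, P.mesh 0 ^ P.d * deriv (fun u => D.dm2 u lam' x) 0 * D.ell ^ 2 * ‖extendZero D.Ω z.2 x‖ ^ 2
      = ∑ x ∈ D.Ω₁, P.mesh 0 ^ P.d * (fun x => deriv (fun u => D.dm2 u lam' x) 0) x * D.ell ^ 2
          * ‖extendZero D.Ω z.2 x‖ ^ 2 := rfl
  rw [hs]
  ring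

/-- **THE REPAIRED INTERACTION (1.5) TO FIRST ORDER, WITH PRINT'S VERTICES**: under the hypotheses of
`B3Eq15ChargeDerivative.interaction15R_one_eq_expectations`,
`𝒫^{(k)}_{n̄=1}(Ω₁, A^{(k)}, φ) = ⟨catalogue of chargeVertex_zero_eq⟩₀ + ⟨λ′-vertex⟩₀` in the base-point measure
`Z₀⁻¹·t·exp[…]|₀ dμ(A′)dφ′↾_Ω` — p. 414 *"the vertices of (1.5) are given by (1.6)–(1.8), (1.10), (1.13), and (1.14) with
n′ = 0 and B̃ = A^{(k)}"* for the typed (1.4) at `n̄ = 1` (the `λ′`-vertex = (1.6) + the `λ′`-derivative counterterms,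
`B3Eq14Finite.lamVertex`). [cite: Balaban1983Higgs3, p.414 (after (1.15)), (1.5) p.412] -/
theorem interaction15R_one_eq_vertices (hmsq : 0 < D.msq) (ha : 0 < D.a) (hL : 1 < (P.L : ℝ))
    (hk1 : 1 ≤ K) (hk : K ≤ P.K) (hℓ : D.ell ≠ 0) (hrun : 0 ≤ D.lamRun) {δ ρ m₀ : ℝ} (hδ : 0 < δ) (hρ : 0 < ρ)
    (hm₀ : 0 < m₀) (hm₀m : m₀ ≤ D.m2) (hmass : ∀ s ∈ Set.Icc (0 : ℝ) δ, ∀ x ∈ D.Ω₁, m₀ ≤ D.m2 + D.dm2 0 s x)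
    (hmass' : ∀ e ∈ Set.Icc (0 - ρ) (0 + ρ), ∀ x ∈ D.Ω₁, m₀ ≤ D.m2 + D.dm2 e 0 x)
    (hdm2 : ∀ x ∈ D.Ω₁, ContDiff ℝ 1 (fun s => D.dm2 0 s x)) (hE1 : ContDiff ℝ 1 (fun s => D.E1 0 s))
    (hdm2' : ∀ x ∈ D.Ω₁, ContDiff ℝ 1 (fun e => D.dm2 e 0 x)) (hE1' : ContDiff ℝ 1 (fun e => D.E1 e 0))
    (Ak : HiggsLattice.VecField P 0) (φ : HiggsLattice.ScalarField P K N) :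
    B3Eq15OneSidedInteraction.interaction15R D 1 Ak φ
      = (∫ z, (prec (B1.aSeq D.a P.L K) (P.mesh K) P.d
              * ∑ y : ↥D.Ωk, ⟪vertex112 φ y.1
                    + vertex113 D.C (((P.L : ℝ) ^ (K * P.d))⁻¹) (fun x => etaSumK Ak K x) (extendZero D.Ω z.2) K y.1,
                  vertex114 D.C (((P.L : ℝ) ^ (K * P.d))⁻¹) (fun x => etaSumK Ak K x) (fluctContour D z.1)
                    (fun _ => 0) (extendZero D.Ω z.2) K 1 0 y.1⟫_ℝ
              - vertex18 D.C D.g Ak (D.fluctSum z.1) 0 (extendZero D.Ω z.2) 1 0 (insideBonds D.Ω)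
              - vertex17 (fun x => deriv (fun u => D.dm2 u 0 x) 0) D.ell D.Ω₁ (extendZero D.Ω z.2)
              + deriv (fun u => D.E1 u 0) 0)
            * (D.kernel14 Ak 0 z.1 φ z.2 * D.density14 Ak 0 0 z.1 (extendZero D.Ω z.2))
            ∂((fluctFamily P D.msq D.a K).prod volume))
          / (∫ A', D.integrand14 0 0 Ak φ A' ∂(fluctFamily P D.msq D.a K))
        + (∫ z, lamVertex D 0 0 (extendZero D.Ω z.2)
            * (D.kernel14 Ak 0 z.1 φ z.2 * D.density14 Ak 0 0 z.1 (extendZero D.Ω z.2))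
            ∂((fluctFamily P D.msq D.a K).prod volume))
          / ∫ A', D.integrand14 0 0 Ak φ A' ∂(fluctFamily P D.msq D.a K) := by
  rw [interaction15R_one_eq_expectations D hmsq ha hL hk1 hk hℓ hrun hδ hρ hm₀ hm₀m hmass hmass' hdm2 hE1 hdm2' hE1'
    Ak φ]
  simp only [chargeVertex_zero_eq]

/-! ## §4. Second order in `e′` (v1.1, append-only): the `e′`-derivative of the charge vertex at `0` -/

section SecondOrder

/-- **`∂²_{e′}|₀(Q_k(e′g_k𝒜 + A^{(k)})φ′)(y) = −2·(1.14)_{2,0}`** (`B3Eq15ChargeSecondOrder.d2AvgQ14` at `0`).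
[cite: Balaban1983Higgs3, (1.14) p.413] -/
theorem d2AvgQ14_zero_eq (Ak : HiggsLattice.VecField P 0) (A' : (j : Fin K) → HiggsLattice.VecField P j)
    (φ' : HiggsLattice.ScalarField P 0 N) (y : HiggsLattice.Site P K) :
    d2AvgQ14 D Ak A' φ' 0 y
      = -((2 : ℝ) • vertex114 D.C (((P.L : ℝ) ^ (K * P.d))⁻¹) (fun x => etaSumK Ak K x) (fluctContour D A')
          (fun _ => 0) φ' K 2 0 y) := by
  set f : ℝ → E N := fun u => -(D.avgQ14 Ak u A' φ' y) with hf
  have hd1 : deriv f = fun u => -dAvgQ14 D Ak A' φ' u y := by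
    funext u
    exact ((hasDerivAt_avgQ14_apply D Ak A' φ' y u).neg).deriv
  have hd2 : iteratedDeriv 2 f 0 = -d2AvgQ14 D Ak A' φ' 0 y := by
    rw [show (2 : ℕ) = 1 + 1 from rfl, iteratedDeriv_succ, iteratedDeriv_one, hd1]
    exact ((hasDerivAt_dAvgQ14_apply D Ak A' φ' y 0).neg).deriv
  have h2 := taylorCoeff_avgQ14_noSmallField D Ak A' φ' y (by norm_num : 1 ≤ 2)
  rw [← hf, hd2, Nat.factorial_two, Nat.cast_ofNat, smul_neg] at h2
  rw [← h2, smul_neg, neg_neg, smul_smul]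
  norm_num

/-- **`dDirichletVertex` at `e′ = 0` is `−2·((1.8)_{2,0} + (1.10)_{2,0})`** (bonds inside `Ω`, `B̃ = A^{(k)}`, `Ã = 0`).
[cite: Balaban1983Higgs3, p.414 (after (1.15)), (1.8)–(1.10) p.413] -/
theorem dDirichletVertex_zero_eq (Ak : HiggsLattice.VecField P 0) (A' : (j : Fin K) → HiggsLattice.VecField P j)
    (φ' : HiggsLattice.ScalarField P 0 N) :
    dDirichletVertex D Ak A' φ' 0
      = -(2 * (vertex18 D.C D.g Ak (D.fluctSum A') 0 φ' 2 0 (insideBonds D.Ω)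
          + vertex110 D.C D.g (D.fluctSum A') 0 φ' 2 0 (insideBonds D.Ω))) := by
  set g : ℝ → ℝ := fun e' => -(1 / 2 : ℝ) * siteInner φ' (covLaplacianN D.C D.Ω (D.extField Ak e' A') φ') with hg
  have hsplit : ∀ u : ℝ, siteInner φ' (D.scalarOp Ak u A' φ')
      = siteInner φ' (covLaplacianN D.C D.Ω (D.extField Ak u A') φ') + (D.m2 * D.ell ^ 2) * siteInner φ' φ' := fun u => by
    rw [Data14.scalarOp_eq]
    unfold siteInner
    rw [Finset.mul_sum, ← Finset.sum_add_distrib]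
    refine Finset.sum_congr rfl fun x _ => ?_
    rw [LinearMap.add_apply, LinearMap.smul_apply, LinearMap.id_apply, Pi.add_apply, Pi.smul_apply, inner_add_right,
      real_inner_smul_right]
    ring
  have hfg : g = fun u => -((1 / 2 : ℝ) * siteInner φ' (D.scalarOp Ak u A' φ'))
      + (1 / 2 : ℝ) * (D.m2 * D.ell ^ 2) * siteInner φ' φ' := by
    funext u
    simp only [hg, hsplit]
    ring
  have hd1 : deriv g = fun u => -dirichletVertex D Ak A' φ' u := by
    funext u
    rw [hfg]
    exact ((hasDerivAt_half_siteInner_scalarOp D Ak A' φ' u).neg.add_const _).deriv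
  have hd2 : iteratedDeriv 2 g 0 = -dDirichletVertex D Ak A' φ' 0 := by
    rw [show (2 : ℕ) = 1 + 1 from rfl, iteratedDeriv_succ, iteratedDeriv_one, hd1]
    exact ((hasDerivAt_dirichletVertex D Ak A' φ' 0).neg).deriv
  have h2 := taylorCoeff_density14_kinetic D Ak A' φ' (by norm_num : 1 ≤ 2)
  rw [← hg, hd2, if_pos (by decide : Even 2), Nat.factorial_two, Nat.cast_ofNat] at h2
  linarith

/-- **`dKernelVertex` at `e′ = 0` = `a_k(L^kη)^{d−2}Σ_{y∈Ω^{(k)}}(2⟨(1.12)+(1.13), (1.14)_{2,0}⟩ + |(1.14)_{1,0}|²)`** — the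
second-order pairs: ((1.12)+(1.13))·(1.14)_{2,0} (different, `−a_k`) and (1.14)_{1,0}·(1.14)_{1,0} (equal, `−½a_k`), times
`−2!`. [cite: Balaban1983Higgs3, p.414 (after (1.15))] -/
theorem dKernelVertex_zero_eq (Ak : HiggsLattice.VecField P 0) (A' : (j : Fin K) → HiggsLattice.VecField P j)
    (φ : HiggsLattice.ScalarField P K N) (φΩ : ↥D.Ω → E N) :
    dKernelVertex D Ak A' φ φΩ 0
      = prec (B1.aSeq D.a P.L K) (P.mesh K) P.d
        * ∑ y : ↥D.Ωk, (2 * ⟪vertex112 φ y.1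
              + vertex113 D.C (((P.L : ℝ) ^ (K * P.d))⁻¹) (fun x => etaSumK Ak K x) (extendZero D.Ω φΩ) K y.1,
            vertex114 D.C (((P.L : ℝ) ^ (K * P.d))⁻¹) (fun x => etaSumK Ak K x) (fluctContour D A') (fun _ => 0)
              (extendZero D.Ω φΩ) K 2 0 y.1⟫_ℝ
            + ‖vertex114 D.C (((P.L : ℝ) ^ (K * P.d))⁻¹) (fun x => etaSumK Ak K x) (fluctContour D A') (fun _ => 0)
              (extendZero D.Ω φΩ) K 1 0 y.1‖ ^ 2) := by
  rw [dKernelVertex_def]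
  simp only [avgQ14_zero_eq, dAvgQ14_zero_eq, d2AvgQ14_zero_eq, inner_neg_right, inner_smul_right, norm_neg,
    sub_neg_eq_add, Finset.mul_sum, ← Finset.sum_neg_distrib]
  refine Finset.sum_congr rfl fun y _ => ?_
  unfold vertex112
  ring

/-- The same as `−2!·Σ_y` of the order-2 coefficient `−½a Σ_{i+j=2}⟨E_i(y), E_j(y)⟩` of
`B3Eq114AveragingVertices.pairing_taylorCoeff` (`Ã = 0`: `E_0 = (1.12)+(1.13)`, `E_1 = (1.14)_{1,0}`, `E_2 = (1.14)_{2,0}`).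
[cite: Balaban1983Higgs3, p.414 (after (1.15))] -/
theorem dKernelVertex_zero_eq_pairing (Ak : HiggsLattice.VecField P 0) (A' : (j : Fin K) → HiggsLattice.VecField P j)
    (φ : HiggsLattice.ScalarField P K N) (φΩ : ↥D.Ω → E N) (nbar : ℕ) :
    dKernelVertex D Ak A' φ φΩ 0
      = -∑ y : ↥D.Ωk, 2 * (-(1 / 2 : ℝ) * prec (B1.aSeq D.a P.L K) (P.mesh K) P.d
          * ∑ ij ∈ Finset.HasAntidiagonal.antidiagonal 2,
              ⟪coeffExpr D.C (((P.L : ℝ) ^ (K * P.d))⁻¹) (fun x => etaSumK Ak K x) (fluctContour D A') (fun _ => 0)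
                  (extendZero D.Ω φΩ) K y.1 φ nbar ij.1,
                coeffExpr D.C (((P.L : ℝ) ^ (K * P.d))⁻¹) (fun x => etaSumK Ak K x) (fluctContour D A') (fun _ => 0)
                  (extendZero D.Ω φΩ) K y.1 φ nbar ij.2⟫_ℝ) := by
  rw [dKernelVertex_zero_eq, Finset.mul_sum, ← Finset.sum_neg_distrib]
  refine Finset.sum_congr rfl fun y _ => ?_
  set w : ℝ := ((P.L : ℝ) ^ (K * P.d))⁻¹ with hw
  set β : HiggsLattice.Site P 0 → ℝ := fun x => etaSumK Ak K x with hβ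
  set φ' := extendZero D.Ω φΩ with hφ'
  -- the coefficient expressions with no small field
  have hEm : ∀ m : ℕ, 1 ≤ m → coeffExpr D.C w β (fluctContour D A') (fun _ => 0) φ' K y.1 φ nbar m
      = vertex114 D.C w β (fluctContour D A') (fun _ => 0) φ' K m 0 y.1 := fun m hm => by
    unfold coeffExpr
    rw [if_neg (by omega), zero_add, B3Eq114AveragingVertices.vertex115_noSmallField, add_zero]
    have hf : (Finset.range (nbar + 1)).filter (fun n' => 1 ≤ m + n')
        = insert 0 ((Finset.range (nbar + 1)).filter (fun n' => 1 ≤ n')) := by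
      ext n'
      simp only [Finset.mem_filter, Finset.mem_range, Finset.mem_insert]
      omega
    rw [hf, Finset.sum_insert (by simp), Finset.sum_eq_zero fun n' hn' => ?_, add_zero]
    rw [Finset.mem_filter] at hn'
    exact B3Eq114AveragingVertices.vertex114_noSmallField D.C w β (fluctContour D A') φ' K y.1 hn'.2 m
  have hE0 : coeffExpr D.C w β (fluctContour D A') (fun _ => 0) φ' K y.1 φ nbar 0
      = vertex112 φ y.1 + vertex113 D.C w β φ' K y.1 := by
    unfold coeffExpr
    rw [if_pos rfl, B3Eq114AveragingVertices.vertex115_noSmallField, add_zero, Finset.sum_eq_zero fun n' hn' => ?_,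
      add_zero]
    rw [Finset.mem_filter] at hn'
    exact B3Eq114AveragingVertices.vertex114_noSmallField D.C w β (fluctContour D A') φ' K y.1 (by omega) 0
  have hanti : Finset.HasAntidiagonal.antidiagonal 2 = {((0 : ℕ), 2), (1, 1), (2, 0)} := by decide
  rw [hanti, Finset.sum_insert (by decide), Finset.sum_pair (by decide), hE0, hEm 1 le_rfl, hEm 2 (by norm_num),
    real_inner_comm (vertex114 D.C w β _ _ φ' K 2 0 y.1), real_inner_self_eq_norm_sq]
  ring

/-- **The `e′`-derivative of the charge vertex at `e′ = 0` (order 2 of (1.5)) is print's second-order catalogue**: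
`dChargeVertex(0) = a_k(L^kη)^{d−2}Σ_y(2⟨(1.12)+(1.13), (1.14)_{2,0}⟩ + |(1.14)_{1,0}|²) − 2((1.8)_{2,0} + (1.10)_{2,0})
− (1.7)[δm_i² = ∂²_{e′}δm²(0,λ′,·)] + ∂²_{e′}E₁(0,λ′)` — i.e. `−2!×`[(1.8)_{2,0} + (1.10)_{2,0} + the two pairs with
`−a_k`/`−½a_k` + (1.7) with `½∂²δm²` − `½∂²E₁`]. [cite: Balaban1983Higgs3, p.414 (after (1.15)), (1.5)–(1.10) pp.412–413] -/
theorem dChargeVertex_zero_eq (lam' : ℝ) (Ak : HiggsLattice.VecField P 0) (φ : HiggsLattice.ScalarField P K N)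
    (z : ((i : Fin K) → HiggsLattice.VecField P i) × (↥D.Ω → E N)) :
    dChargeVertex D lam' Ak φ 0 z
      = prec (B1.aSeq D.a P.L K) (P.mesh K) P.d
          * ∑ y : ↥D.Ωk, (2 * ⟪vertex112 φ y.1
                + vertex113 D.C (((P.L : ℝ) ^ (K * P.d))⁻¹) (fun x => etaSumK Ak K x) (extendZero D.Ω z.2) K y.1,
              vertex114 D.C (((P.L : ℝ) ^ (K * P.d))⁻¹) (fun x => etaSumK Ak K x) (fluctContour D z.1) (fun _ => 0)
                (extendZero D.Ω z.2) K 2 0 y.1⟫_ℝ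
              + ‖vertex114 D.C (((P.L : ℝ) ^ (K * P.d))⁻¹) (fun x => etaSumK Ak K x) (fluctContour D z.1) (fun _ => 0)
                (extendZero D.Ω z.2) K 1 0 y.1‖ ^ 2)
        - 2 * (vertex18 D.C D.g Ak (D.fluctSum z.1) 0 (extendZero D.Ω z.2) 2 0 (insideBonds D.Ω)
            + vertex110 D.C D.g (D.fluctSum z.1) 0 (extendZero D.Ω z.2) 2 0 (insideBonds D.Ω))
        - vertex17 (fun x => deriv (deriv fun u => D.dm2 u lam' x) 0) D.ell D.Ω₁ (extendZero D.Ω z.2)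
        + deriv (deriv fun u => D.E1 u lam') 0 := by
  rw [dChargeVertex_def, dKernelVertex_zero_eq, dDensityVertex_def, dDirichletVertex_zero_eq]
  unfold vertex17
  have hs : ∑ x ∈ D.Ω₁, P.mesh 0 ^ P.d * deriv (deriv fun u => D.dm2 u lam' x) 0 * D.ell ^ 2 * ‖extendZero D.Ω z.2 x‖ ^ 2
      = ∑ x ∈ D.Ω₁, P.mesh 0 ^ P.d * (fun x => deriv (deriv fun u => D.dm2 u lam' x) 0) x * D.ell ^ 2
          * ‖extendZero D.Ω z.2 x‖ ^ 2 := rfl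
  rw [hs]
  ring

/-- Print's FIRST-ORDER catalogue (the right-hand side of `chargeVertex_zero_eq`) as a function on the product space.
[cite: Balaban1983Higgs3, p.414 (after (1.15))] -/
def catalogue1 (lam' : ℝ) (Ak : HiggsLattice.VecField P 0) (φ : HiggsLattice.ScalarField P K N)
    (z : ((i : Fin K) → HiggsLattice.VecField P i) × (↥D.Ω → E N)) : ℝ :=
  prec (B1.aSeq D.a P.L K) (P.mesh K) P.d
      * ∑ y : ↥D.Ωk, ⟪vertex112 φ y.1
            + vertex113 D.C (((P.L : ℝ) ^ (K * P.d))⁻¹) (fun x => etaSumK Ak K x) (extendZero D.Ω z.2) K y.1,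
          vertex114 D.C (((P.L : ℝ) ^ (K * P.d))⁻¹) (fun x => etaSumK Ak K x) (fluctContour D z.1) (fun _ => 0)
            (extendZero D.Ω z.2) K 1 0 y.1⟫_ℝ
    - vertex18 D.C D.g Ak (D.fluctSum z.1) 0 (extendZero D.Ω z.2) 1 0 (insideBonds D.Ω)
    - vertex17 (fun x => deriv (fun u => D.dm2 u lam' x) 0) D.ell D.Ω₁ (extendZero D.Ω z.2)
    + deriv (fun u => D.E1 u lam') 0

/-- Print's SECOND-ORDER catalogue (the right-hand side of `dChargeVertex_zero_eq`).
[cite: Balaban1983Higgs3, p.414 (after (1.15))] -/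
def catalogue2 (lam' : ℝ) (Ak : HiggsLattice.VecField P 0) (φ : HiggsLattice.ScalarField P K N)
    (z : ((i : Fin K) → HiggsLattice.VecField P i) × (↥D.Ω → E N)) : ℝ :=
  prec (B1.aSeq D.a P.L K) (P.mesh K) P.d
      * ∑ y : ↥D.Ωk, (2 * ⟪vertex112 φ y.1
            + vertex113 D.C (((P.L : ℝ) ^ (K * P.d))⁻¹) (fun x => etaSumK Ak K x) (extendZero D.Ω z.2) K y.1,
          vertex114 D.C (((P.L : ℝ) ^ (K * P.d))⁻¹) (fun x => etaSumK Ak K x) (fluctContour D z.1) (fun _ => 0)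
            (extendZero D.Ω z.2) K 2 0 y.1⟫_ℝ
          + ‖vertex114 D.C (((P.L : ℝ) ^ (K * P.d))⁻¹) (fun x => etaSumK Ak K x) (fluctContour D z.1) (fun _ => 0)
            (extendZero D.Ω z.2) K 1 0 y.1‖ ^ 2)
    - 2 * (vertex18 D.C D.g Ak (D.fluctSum z.1) 0 (extendZero D.Ω z.2) 2 0 (insideBonds D.Ω)
        + vertex110 D.C D.g (D.fluctSum z.1) 0 (extendZero D.Ω z.2) 2 0 (insideBonds D.Ω))
    - vertex17 (fun x => deriv (deriv fun u => D.dm2 u lam' x) 0) D.ell D.Ω₁ (extendZero D.Ω z.2)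
    + deriv (deriv fun u => D.E1 u lam') 0

/-- `chargeVertex(0) = catalogue1`. [cite: Balaban1983Higgs3, p.414 (after (1.15))] -/
theorem chargeVertex_zero_eq_catalogue1 (lam' : ℝ) (Ak : HiggsLattice.VecField P 0)
    (φ : HiggsLattice.ScalarField P K N) (z : ((i : Fin K) → HiggsLattice.VecField P i) × (↥D.Ω → E N)) :
    chargeVertex D lam' Ak φ 0 z = catalogue1 D lam' Ak φ z := chargeVertex_zero_eq D lam' Ak φ z

/-- `dChargeVertex(0) = catalogue2`. [cite: Balaban1983Higgs3, p.414 (after (1.15))] -/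
theorem dChargeVertex_zero_eq_catalogue2 (lam' : ℝ) (Ak : HiggsLattice.VecField P 0)
    (φ : HiggsLattice.ScalarField P K N) (z : ((i : Fin K) → HiggsLattice.VecField P i) × (↥D.Ω → E N)) :
    dChargeVertex D lam' Ak φ 0 z = catalogue2 D lam' Ak φ z := dChargeVertex_zero_eq D lam' Ak φ z

/-- **THE REPAIRED INTERACTION (1.5) FOR `n̄ = 2`, WITH PRINT'S VERTICES**: `B3Eq15ChargeSecondOrder.interaction15R_two_eq_expectations`
with the charge vertex and its `e′`-derivative replaced by the catalogues of `chargeVertex_zero_eq` / `dChargeVertex_zero_eq`: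
`𝒫^{(k)}_{n̄=2} = ⟨cat₁⟩₀ + ⟨V⟩₀ + ½(⟨cat₂⟩₀ − (⟨cat₁²⟩₀ − ⟨cat₁⟩₀²)) + (⟨∂_{e′}V⟩₀ − (⟨V·cat₁⟩₀ − ⟨V⟩₀⟨cat₁⟩₀)) + ½(⟨∂_{λ′}V⟩₀ − Var₀V)`
(hypotheses (H2) of that theorem). [cite: Balaban1983Higgs3, p.414 (after (1.15)), (1.5) p.412] -/
theorem interaction15R_two_eq_vertices (hmsq : 0 < D.msq) (ha : 0 < D.a) (hL : 1 < (P.L : ℝ))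
    (hk1 : 1 ≤ K) (hk : K ≤ P.K) (hℓ : D.ell ≠ 0) (hrun : 0 ≤ D.lamRun) {δ ρ m₀ : ℝ} (hδ : 0 < δ) (hρ : 0 < ρ)
    (hm₀ : 0 < m₀) (hm₀m : m₀ ≤ D.m2)
    (hmass : ∀ e ∈ Set.Icc (-ρ) ρ, ∀ s ∈ Set.Icc (0 : ℝ) δ, ∀ x ∈ D.Ω₁, m₀ ≤ D.m2 + D.dm2 e s x)
    (hdm2s0 : ∀ x ∈ D.Ω₁, ContDiff ℝ 2 (fun s => D.dm2 0 s x)) (hE1s0 : ContDiff ℝ 2 (fun s => D.E1 0 s))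
    (hdm2s : ∀ e ∈ Set.Icc (-ρ) ρ, ∀ x ∈ D.Ω₁, ContDiff ℝ 1 (fun s => D.dm2 e s x))
    (hE1s : ∀ e ∈ Set.Icc (-ρ) ρ, ContDiff ℝ 1 (fun s => D.E1 e s))
    (hdm2e : ∀ x ∈ D.Ω₁, ContDiff ℝ 2 (fun e => D.dm2 e 0 x)) (hE1e : ContDiff ℝ 2 (fun e => D.E1 e 0))
    (hVm : ∀ x ∈ D.Ω₁, ContDiff ℝ 1 (fun u => deriv (fun s => D.dm2 u s x) 0))
    (hVE : ContDiff ℝ 1 (fun u => deriv (fun s => D.E1 u s) 0))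
    (Ak : HiggsLattice.VecField P 0) (φ : HiggsLattice.ScalarField P K N) :
    B3Eq15OneSidedInteraction.interaction15R D 2 Ak φ
      = (∫ z, catalogue1 D 0 Ak φ z
            * (D.kernel14 Ak 0 z.1 φ z.2 * D.density14 Ak 0 0 z.1 (extendZero D.Ω z.2))
            ∂((fluctFamily P D.msq D.a K).prod volume))
          / (∫ A', D.integrand14 0 0 Ak φ A' ∂(fluctFamily P D.msq D.a K))
        + (∫ z, lamVertex D 0 0 (extendZero D.Ω z.2)
            * (D.kernel14 Ak 0 z.1 φ z.2 * D.density14 Ak 0 0 z.1 (extendZero D.Ω z.2))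
            ∂((fluctFamily P D.msq D.a K).prod volume))
          / (∫ A', D.integrand14 0 0 Ak φ A' ∂(fluctFamily P D.msq D.a K))
        + (1 / 2 : ℝ) * ((∫ z, catalogue2 D 0 Ak φ z
            * (D.kernel14 Ak 0 z.1 φ z.2 * D.density14 Ak 0 0 z.1 (extendZero D.Ω z.2))
            ∂((fluctFamily P D.msq D.a K).prod volume))
          / (∫ A', D.integrand14 0 0 Ak φ A' ∂(fluctFamily P D.msq D.a K))
          - ((∫ z, catalogue1 D 0 Ak φ z ^ 2
            * (D.kernel14 Ak 0 z.1 φ z.2 * D.density14 Ak 0 0 z.1 (extendZero D.Ω z.2))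
            ∂((fluctFamily P D.msq D.a K).prod volume))
          / (∫ A', D.integrand14 0 0 Ak φ A' ∂(fluctFamily P D.msq D.a K))
            - ((∫ z, catalogue1 D 0 Ak φ z
            * (D.kernel14 Ak 0 z.1 φ z.2 * D.density14 Ak 0 0 z.1 (extendZero D.Ω z.2))
            ∂((fluctFamily P D.msq D.a K).prod volume))
          / (∫ A', D.integrand14 0 0 Ak φ A' ∂(fluctFamily P D.msq D.a K))) ^ 2))
        + ((∫ z, dLamVertexCharge D 0 0 (extendZero D.Ω z.2)
            * (D.kernel14 Ak 0 z.1 φ z.2 * D.density14 Ak 0 0 z.1 (extendZero D.Ω z.2))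
            ∂((fluctFamily P D.msq D.a K).prod volume))
          / (∫ A', D.integrand14 0 0 Ak φ A' ∂(fluctFamily P D.msq D.a K))
          - ((∫ z, lamVertex D 0 0 (extendZero D.Ω z.2) * catalogue1 D 0 Ak φ z
            * (D.kernel14 Ak 0 z.1 φ z.2 * D.density14 Ak 0 0 z.1 (extendZero D.Ω z.2))
            ∂((fluctFamily P D.msq D.a K).prod volume))
          / (∫ A', D.integrand14 0 0 Ak φ A' ∂(fluctFamily P D.msq D.a K))
            - (∫ z, lamVertex D 0 0 (extendZero D.Ω z.2)
            * (D.kernel14 Ak 0 z.1 φ z.2 * D.density14 Ak 0 0 z.1 (extendZero D.Ω z.2))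
            ∂((fluctFamily P D.msq D.a K).prod volume))
          / (∫ A', D.integrand14 0 0 Ak φ A' ∂(fluctFamily P D.msq D.a K))
              * ((∫ z, catalogue1 D 0 Ak φ z
            * (D.kernel14 Ak 0 z.1 φ z.2 * D.density14 Ak 0 0 z.1 (extendZero D.Ω z.2))
            ∂((fluctFamily P D.msq D.a K).prod volume))
          / (∫ A', D.integrand14 0 0 Ak φ A' ∂(fluctFamily P D.msq D.a K)))))
        + (1 / 2 : ℝ) * ((∫ z, lamVertex2 D 0 0 (extendZero D.Ω z.2)
            * (D.kernel14 Ak 0 z.1 φ z.2 * D.density14 Ak 0 0 z.1 (extendZero D.Ω z.2))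
            ∂((fluctFamily P D.msq D.a K).prod volume))
          / (∫ A', D.integrand14 0 0 Ak φ A' ∂(fluctFamily P D.msq D.a K))
          - ((∫ z, lamVertex D 0 0 (extendZero D.Ω z.2) ^ 2
            * (D.kernel14 Ak 0 z.1 φ z.2 * D.density14 Ak 0 0 z.1 (extendZero D.Ω z.2))
            ∂((fluctFamily P D.msq D.a K).prod volume))
          / (∫ A', D.integrand14 0 0 Ak φ A' ∂(fluctFamily P D.msq D.a K))
            - ((∫ z, lamVertex D 0 0 (extendZero D.Ω z.2)
            * (D.kernel14 Ak 0 z.1 φ z.2 * D.density14 Ak 0 0 z.1 (extendZero D.Ω z.2))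
            ∂((fluctFamily P D.msq D.a K).prod volume))
          / (∫ A', D.integrand14 0 0 Ak φ A' ∂(fluctFamily P D.msq D.a K))) ^ 2)) := by
  rw [interaction15R_two_eq_expectations D hmsq ha hL hk1 hk hℓ hrun hδ hρ hm₀ hm₀m hmass hdm2s0 hE1s0 hdm2s hE1s
    hdm2e hE1e hVm hVE Ak φ]
  simp only [chargeVertex_zero_eq_catalogue1, dChargeVertex_zero_eq_catalogue2]

end SecondOrder

/-! ## §5. Every order `n` at the level of the exponent of the integrand of (1.4) (v1.2, append-only) -/

section AllOrders

open Literature.MathematicalPhysics.QuantumFieldTheory.Balaban1983to89.B1RT (prec)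
open Literature.MathematicalPhysics.QuantumFieldTheory.Balaban1983to89.B3Eq114AveragingVertices
  (contDiff_kernelTerm log_kernel14_eq taylorCoeff_log_kernel14)
open Literature.MathematicalPhysics.QuantumFieldTheory.Balaban1983to89.B3Eq18VertexExpansion
  (gmul kinBond contDiff_kinBond kineticForm_eq_sum_kinBond siteMul_eq_gmul)

/-- The kinetic term of the exponent of (1.4) is smooth in `e′` (a finite sum of the bond densities of
`B3Eq18VertexExpansion`). [cite: Balaban1983Higgs3, (1.4) p.412] -/
theorem contDiff_kinetic14 (Ak : HiggsLattice.VecField P 0) (A' : (j : Fin K) → HiggsLattice.VecField P j)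
    (φ' : HiggsLattice.ScalarField P 0 N) {m : ℕ∞} :
    ContDiff ℝ m (fun e' : ℝ => -(1 / 2 : ℝ) * siteInner φ' (covLaplacianN D.C D.Ω (D.extField Ak e' A') φ')) := by
  have hfun : (fun e' : ℝ => -(1 / 2 : ℝ) * siteInner φ' (covLaplacianN D.C D.Ω (D.extField Ak e' A') φ'))
      = fun s : ℝ => ∑ b ∈ insideBonds D.Ω, kinBond D.C D.g Ak (D.fluctSum A') 0 φ' b s := by
    funext s
    rw [Data14.extField_eq, siteMul_eq_gmul, add_comm, ← kineticForm_eq_sum_kinBond, add_zero]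
  rw [hfun]
  exact ContDiff.sum fun b _ => contDiff_kinBond D.C D.g Ak (D.fluctSum A') 0 φ' b

/-- The logarithm of the kernel `t(Ω; φ, φ′)` of (1.4) is smooth in `e′`. [cite: Balaban1983Higgs3, (1.4) p.412] -/
theorem contDiff_log_kernel14 (hκ : 0 < prec (B1.aSeq D.a P.L K) (P.mesh K) P.d) (Ak : HiggsLattice.VecField P 0)
    (A' : (j : Fin K) → HiggsLattice.VecField P j) (φ : HiggsLattice.ScalarField P K N) (φΩ : ↥D.Ω → E N) {m : ℕ∞} :
    ContDiff ℝ m (fun e' : ℝ => Real.log (D.kernel14 Ak e' A' φ φΩ)) := by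
  have hfun : (fun e' : ℝ => Real.log (D.kernel14 Ak e' A' φ φΩ))
      = fun e' => (Fintype.card ↥D.Ωk : ℝ)
          * Real.log ((prec (B1.aSeq D.a P.L K) (P.mesh K) P.d / (2 * Real.pi)) ^ ((Module.finrank ℝ (E N) : ℝ) / 2))
        + ∑ y : ↥D.Ωk, -(1 / 2 : ℝ) * prec (B1.aSeq D.a P.L K) (P.mesh K) P.d
            * ‖vertex112 φ y.1 + avgTerm D.C (((P.L : ℝ) ^ (K * P.d))⁻¹) (fun x => etaSumK Ak K x) (fluctContour D A')
                (fun x => etaSumK (0 : HiggsLattice.VecField P 0) K x) (extendZero D.Ω φΩ) K y.1 e'‖ ^ 2 := by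
    funext e'
    rw [← log_kernel14_eq D hκ 0 Ak A' φ φΩ e', zero_add]
  rw [hfun]
  exact contDiff_const.add (ContDiff.sum fun y _ => contDiff_kernelTerm D.C _ _ _ _ _ _ K φ y.1)

/-- **p. 414 at EVERY order `n ≥ 1`, at the level of the exponent of the integrand of (1.4)** (`B̃ = A^{(k)}`, `Ã = 0`): the
`e′`-Taylor coefficient of order `n` of `log t(Ω; φ, φ′) − ½⟨φ′, (−Δ^η_{e′g_k𝒜 + A^{(k)},Ω})φ′⟩` is
`Σ_{y∈Ω^{(k)}} (−½a_k(L^kη)^{d−2} Σ_{i+j=n}⟨E_i(y), E_j(y)⟩) + (1.8)_{n,0} + [n even]·(1.10)_{n,0}` — the pairings of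
(1.12)–(1.14)_{·,0} summed over `y` (`B3Eq114AveragingVertices.taylorCoeff_log_kernel14`) plus the action vertices
(`B3Eq18VertexExpansion.taylorCoeff_density14_kinetic`); the remaining, `e′`-dependent terms of the exponent are the
counterterms `−½Σ_xη^dδm²(e′,λ′,x)(L^kε)²|φ′(x)|² − E₁(e′,λ′)`, whose coefficients are the vertices (1.7) with `(1/n!)∂ⁿ_{e′}δm²`
and `−(1/n!)∂ⁿ_{e′}E₁` (orders 1, 2: §3, §4). *"the vertices of (1.5) are given by (1.6)–(1.8), (1.10), (1.13), and (1.14) with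
n′ = 0 and B̃ = A^{(k)}"*. [cite: Balaban1983Higgs3, p.414 (after (1.15))] -/
theorem taylorCoeff_log_kernel_kinetic (hκ : 0 < prec (B1.aSeq D.a P.L K) (P.mesh K) P.d) (Ak : HiggsLattice.VecField P 0)
    (A' : (j : Fin K) → HiggsLattice.VecField P j) (φ : HiggsLattice.ScalarField P K N) (φΩ : ↥D.Ω → E N) (nbar : ℕ)
    {n : ℕ} (hn : 1 ≤ n) :
    ((n.factorial : ℝ)⁻¹)
        * iteratedDeriv n (fun e' : ℝ => Real.log (D.kernel14 Ak e' A' φ φΩ)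
            + -(1 / 2 : ℝ) * siteInner (extendZero D.Ω φΩ) (covLaplacianN D.C D.Ω (D.extField Ak e' A') (extendZero D.Ω φΩ))) 0
      = (∑ y : ↥D.Ωk, -(1 / 2 : ℝ) * prec (B1.aSeq D.a P.L K) (P.mesh K) P.d
          * ∑ ij ∈ Finset.HasAntidiagonal.antidiagonal n,
              ⟪coeffExpr D.C (((P.L : ℝ) ^ (K * P.d))⁻¹) (fun x => etaSumK Ak K x) (fluctContour D A')
                  (fun x => etaSumK (0 : HiggsLattice.VecField P 0) K x) (extendZero D.Ω φΩ) K y.1 φ nbar ij.1,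
                coeffExpr D.C (((P.L : ℝ) ^ (K * P.d))⁻¹) (fun x => etaSumK Ak K x) (fluctContour D A')
                  (fun x => etaSumK (0 : HiggsLattice.VecField P 0) K x) (extendZero D.Ω φΩ) K y.1 φ nbar ij.2⟫_ℝ)
        + (vertex18 D.C D.g Ak (D.fluctSum A') 0 (extendZero D.Ω φΩ) n 0 (insideBonds D.Ω)
          + (if Even n then vertex110 D.C D.g (D.fluctSum A') 0 (extendZero D.Ω φΩ) n 0 (insideBonds D.Ω) else 0)) := by
  set φ' := extendZero D.Ω φΩ with hφ'
  set L1 : ℝ → ℝ := fun e' => Real.log (D.kernel14 Ak e' A' φ φΩ) with hL1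
  set L2 : ℝ → ℝ := fun e' => -(1 / 2 : ℝ) * siteInner φ' (covLaplacianN D.C D.Ω (D.extField Ak e' A') φ') with hL2
  have h1 : ContDiff ℝ n L1 := contDiff_log_kernel14 D hκ Ak A' φ φΩ
  have h2 : ContDiff ℝ n L2 := contDiff_kinetic14 D Ak A' φ'
  have hadd : (fun e' : ℝ => L1 e' + L2 e') = L1 + L2 := rfl
  rw [hadd, iteratedDeriv_add h1.contDiffAt h2.contDiffAt, mul_add, hL2, taylorCoeff_density14_kinetic D Ak A' φ' hn]
  congr 1
  have hk : L1 = fun e' => Real.log (D.kernel14 (0 + Ak) e' A' φ φΩ) := by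
    funext e'
    rw [hL1, zero_add]
  rw [hk, taylorCoeff_log_kernel14 D hκ 0 Ak A' φ φΩ nbar hn]

end AllOrders

/-! ## §6. Every order `n`: the whole exponent of the integrand `t·exp[…]` of (1.4), counterterms included (v1.3, append-only) -/

section WholeExponent

open Literature.MathematicalPhysics.QuantumFieldTheory.Balaban1983to89.B1RT (prec rtKernel_pos)
open Literature.MathematicalPhysics.QuantumFieldTheory.Balaban1983to89.B3Eq18VertexExpansion (vertex16 log_density14_eq)

/-- The kernel `t(Ω; φ, φ′)` of (1.4) is strictly positive (`κ > 0`). [cite: Balaban1982Higgs1, (2.10) p.609] -/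
theorem kernel14_pos (hκ : 0 < prec (B1.aSeq D.a P.L K) (P.mesh K) P.d) (Ak : HiggsLattice.VecField P 0) (e' : ℝ)
    (A' : (j : Fin K) → HiggsLattice.VecField P j) (φ : HiggsLattice.ScalarField P K N) (φΩ : ↥D.Ω → E N) :
    0 < D.kernel14 Ak e' A' φ φΩ := by
  rw [Data14.kernel14_eq]
  exact Finset.prod_pos fun y _ => rtKernel_pos hκ _

/-- The counterterm vertex (1.7) along a differentiable family of counterterms: its `n`-th `e′`-derivative is (1.7) with the
`n`-th derivative of the counterterm (linearity of (1.7) in `δm_i²`). [cite: Balaban1983Higgs3, (1.7) p.413] -/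
theorem iteratedDeriv_vertex17 (f : ℝ → HiggsLattice.Site P 0 → ℝ) (ell : ℝ) (Ω₁ : Finset (HiggsLattice.Site P 0))
    (φ' : HiggsLattice.ScalarField P 0 N) {n : ℕ} (hf : ∀ x ∈ Ω₁, ContDiff ℝ n (fun u => f u x)) (e : ℝ) :
    iteratedDeriv n (fun u => vertex17 (f u) ell Ω₁ φ') e = vertex17 (fun x => iteratedDeriv n (fun u => f u x) e) ell Ω₁ φ' := by
  unfold vertex17
  have hterm : ∀ x ∈ Ω₁, ContDiffAt ℝ n (fun u => P.mesh 0 ^ P.d * f u x * ell ^ 2 * ‖φ' x‖ ^ 2) e := fun x hx => by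
    have h := ((hf x hx).mul contDiff_const : ContDiff ℝ n fun u => f u x * (P.mesh 0 ^ P.d * ell ^ 2 * ‖φ' x‖ ^ 2))
    have heq : (fun u => P.mesh 0 ^ P.d * f u x * ell ^ 2 * ‖φ' x‖ ^ 2)
        = fun u => f u x * (P.mesh 0 ^ P.d * ell ^ 2 * ‖φ' x‖ ^ 2) := by
      funext u; ring
    rw [heq]
    exact h.contDiffAt
  rw [iteratedDeriv_const_mul _ (ContDiffAt.sum fun x hx => hterm x hx), iteratedDeriv_fun_sum fun x hx => hterm x hx]
  congr 1
  refine Finset.sum_congr rfl fun x hx => ?_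
  have heq : (fun u => P.mesh 0 ^ P.d * f u x * ell ^ 2 * ‖φ' x‖ ^ 2)
      = fun u => (P.mesh 0 ^ P.d * ell ^ 2 * ‖φ' x‖ ^ 2) * f u x := by
    funext u; ring
  rw [heq, iteratedDeriv_const_mul _ (hf x hx).contDiffAt]
  ring

/-- **p. 414 at EVERY order `n ≥ 1` for the WHOLE exponent of the integrand `t(Ω;φ,φ′)·exp[…]` of (1.4)** (`B̃ = A^{(k)}`,
`Ã = 0`; counterterm data `δm²(·,λ′,x)`, `E₁(·,λ′)` of class `Cⁿ` in `e′`):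
`(1/n!)·∂ⁿ_{e′}|₀ log(t·exp[…]) = Σ_{y∈Ω^{(k)}}(−½a_k(L^kη)^{d−2}Σ_{i+j=n}⟨E_i(y),E_j(y)⟩) + (1.8)_{n,0} + [n even]·(1.10)_{n,0}
+ (1.7)[δm_i² = (1/n!)∂ⁿ_{e′}δm²(0,λ′,·)] − (1/n!)∂ⁿ_{e′}E₁(0,λ′)` — all of print's *"(1.6)–(1.8), (1.10), (1.13), and (1.14) with
n′ = 0 and B̃ = A^{(k)}"* ((1.6) carries no `e′`; (1.13)/(1.14) inside the pairings `E_i(y)`).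
[cite: Balaban1983Higgs3, p.414 (after (1.15)), (1.4)–(1.7) pp.412–413] -/
theorem taylorCoeff_log_fibre14 (hκ : 0 < prec (B1.aSeq D.a P.L K) (P.mesh K) P.d) (lam' : ℝ)
    (Ak : HiggsLattice.VecField P 0) (A' : (j : Fin K) → HiggsLattice.VecField P j) (φ : HiggsLattice.ScalarField P K N)
    (φΩ : ↥D.Ω → E N) (nbar : ℕ) {n : ℕ} (hn : 1 ≤ n)
    (hdm2 : ∀ x ∈ D.Ω₁, ContDiff ℝ n (fun u => D.dm2 u lam' x)) (hE1 : ContDiff ℝ n (fun u => D.E1 u lam')) :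
    ((n.factorial : ℝ)⁻¹)
        * iteratedDeriv n (fun e' : ℝ =>
            Real.log (D.kernel14 Ak e' A' φ φΩ * D.density14 Ak e' lam' A' (extendZero D.Ω φΩ))) 0
      = (∑ y : ↥D.Ωk, -(1 / 2 : ℝ) * prec (B1.aSeq D.a P.L K) (P.mesh K) P.d
          * ∑ ij ∈ Finset.HasAntidiagonal.antidiagonal n,
              ⟪coeffExpr D.C (((P.L : ℝ) ^ (K * P.d))⁻¹) (fun x => etaSumK Ak K x) (fluctContour D A')
                  (fun x => etaSumK (0 : HiggsLattice.VecField P 0) K x) (extendZero D.Ω φΩ) K y.1 φ nbar ij.1,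
                coeffExpr D.C (((P.L : ℝ) ^ (K * P.d))⁻¹) (fun x => etaSumK Ak K x) (fluctContour D A')
                  (fun x => etaSumK (0 : HiggsLattice.VecField P 0) K x) (extendZero D.Ω φΩ) K y.1 φ nbar ij.2⟫_ℝ)
        + (vertex18 D.C D.g Ak (D.fluctSum A') 0 (extendZero D.Ω φΩ) n 0 (insideBonds D.Ω)
          + (if Even n then vertex110 D.C D.g (D.fluctSum A') 0 (extendZero D.Ω φΩ) n 0 (insideBonds D.Ω) else 0))
        + vertex17 (fun x => ((n.factorial : ℝ)⁻¹) * iteratedDeriv n (fun u => D.dm2 u lam' x) 0) D.ell D.Ω₁ (extendZero D.Ω φΩ)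
        - ((n.factorial : ℝ)⁻¹) * iteratedDeriv n (fun u => D.E1 u lam') 0 := by
  set φ' := extendZero D.Ω φΩ with hφ'
  -- the exponent = (log t + kinetic) + (constants + (1.7)-term − E₁)
  set G : ℝ → ℝ := fun e' => Real.log (D.kernel14 Ak e' A' φ φΩ)
    + -(1 / 2 : ℝ) * siteInner φ' (covLaplacianN D.C D.Ω (D.extField Ak e' A') φ') with hG
  set c0 : ℝ := -((1 / 2 : ℝ) * (D.m2 * D.ell ^ 2) * siteInner φ' φ') + lam' * vertex16 D.lamRun D.Ω₁ φ' with hc0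
  set V : ℝ → ℝ := fun e' => vertex17 (D.dm2 e' lam') D.ell D.Ω₁ φ' with hV
  set W : ℝ → ℝ := fun e' => D.E1 e' lam' with hW
  have hfun : (fun e' : ℝ => Real.log (D.kernel14 Ak e' A' φ φΩ * D.density14 Ak e' lam' A' φ'))
      = G + ((fun _ => c0) + (V - W)) := by
    funext e'
    rw [Real.log_mul (kernel14_pos D hκ Ak e' A' φ φΩ).ne' (Data14.density14_pos D Ak e' lam' A' φ').ne',
      log_density14_eq]
    simp only [hG, hc0, hV, hW, Pi.add_apply, Pi.sub_apply]
    ring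
  have hGd : ContDiff ℝ n G := (contDiff_log_kernel14 D hκ Ak A' φ φΩ).add (contDiff_kinetic14 D Ak A' φ')
  have hVd : ContDiff ℝ n V := by
    have h : ContDiff ℝ n (fun e' : ℝ =>
        -(1 / 2 : ℝ) * ∑ x ∈ D.Ω₁, P.mesh 0 ^ P.d * D.dm2 e' lam' x * D.ell ^ 2 * ‖φ' x‖ ^ 2) :=
      contDiff_const.mul (ContDiff.sum fun x hx =>
        ((contDiff_const.mul (hdm2 x hx)).mul contDiff_const).mul contDiff_const)
    exact h
  have hWd : ContDiff ℝ n W := hE1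
  have hK1 : ContDiff ℝ n (V - W) := hVd.sub hWd
  have hK : ContDiff ℝ n ((fun _ : ℝ => c0) + (V - W)) := contDiff_const.add hK1
  rw [hfun, iteratedDeriv_add hGd.contDiffAt hK.contDiffAt, iteratedDeriv_add contDiff_const.contDiffAt hK1.contDiffAt,
    iteratedDeriv_sub hVd.contDiffAt hWd.contDiffAt, iteratedDeriv_const, if_neg (by omega), zero_add, hG,
    mul_add, taylorCoeff_log_kernel_kinetic D hκ Ak A' φ φΩ nbar hn, hV, iteratedDeriv_vertex17 _ _ _ _ hdm2, hW]
  -- the (1.7)-term is linear in the counterterm: pull `(n!)⁻¹` inside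
  have hlin : ∀ (c : ℝ) (f : HiggsLattice.Site P 0 → ℝ),
      c * vertex17 f D.ell D.Ω₁ φ' = vertex17 (fun x => c * f x) D.ell D.Ω₁ φ' := fun c f => by
    unfold vertex17
    rw [mul_left_comm, Finset.mul_sum]
    congr 1
    exact Finset.sum_congr rfl fun x _ => by ring
  rw [mul_sub, hlin]
  ring

end WholeExponent

end

end Literature.MathematicalPhysics.QuantumFieldTheory.Balaban1983to89.B3Eq15ChargeVertexCatalogue
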